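import Summits.ResolutionOfSingularities.ResolutionOfSingularities.Theorems.KThread
import Summits.ResolutionOfSingularities.ResolutionOfSingularities.Theorems.KCarrier
import Summits.ResolutionOfSingularities.ResolutionOfSingularities.Theorems.KChain
import HarnessLib

/-!
# «KStage» — the `K`-side stages `B̃_i = (B_i ⊗_k K)_{𝔴_i}` of the tower dictionary, read in the field `L′`

(lens-5 g39, node g39m; critic ROW 232 Q2a / ROW 238 window, door (M-Dict); letters 238a f1–f7 / 238b–g.)

Layer E of `towerDictionary_holds` feeds `KRoot.exists_root_frame` (stage 0) and `KRoot.kframe_step` (every stage) with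
hypotheses about the local subrings `B̃_i ⊆ L′`.  For a local `k`-subalgebra `B ⊆ L` (`k ⊆ K ⊆ L` fields, `K/k` separable),
the multiplication map `μ_B : B ⊗_k K → L` [Theorems/KThread] and a prime `𝔴` of `B ⊗_k K`, the carrier
`B̃ = KCarrier.carrier μ_B 𝔴 = {μ y / μ z : z ∉ 𝔴}` [Theorems/KCarrier] satisfies, when `𝔴` is a `K`-RATIONAL maximal ideal
over `𝔪_B` (the thread of `K`-points [Theorems/KChain]):

* §1 `mulMap`, `mulMap_tmul`; `algebraMap_mem_carrier` (`K ⊆ B̃`), `coe_mem_carrier` (`B ⊆ B̃`), `coe_mem_unitSet` (units of `B`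
  are units of `B̃`), `range_le` (`μ(B ⊗ K) ⊆` any subring containing `B` and `K`), `exists_frac` (`B̃` is a ring of fractions of
  `μ(B ⊗ K)` with denominators invertible in `B̃` — the `hfrac` of `FrameStep.le_frameRing_of_frac`), `exists_sub_mem_maxSet`
  (the `hrat` of `frame_step`), `inclusion_eq` + `map_maximalIdeal_eq` (`𝔪_B B̃ = 𝔪_{B̃}`, from [Theorems/KFibre, KThread]) and its
  reading `mem_maxSet_iff_mem_map` (the `hM` of `KRoot.kframe_step`), `coe_mem_pow_maximalIdeal` (`𝔪_B^n ⊆ 𝔪_{B̃}^n`);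
* §2 two stages `B ≤ B'` with compatible points `𝔴' ∩ (B ⊗ K) = 𝔴`: `carrier_le₂`, `maxSet_subset₂`, `unitSet_subset₂` and
  `exists_gen₂` (the `hgen` of `KCert.transport` / `KRoot.kframe_step`);
* §3 `exists_pointThread_subalgebra` — the thread of `K`-rational points over a chain of local `k`-subalgebras of `L` with local
  inclusions and residue fields algebraic over `k` (`KChain.exists_pointThread`).

All elementary.  (Sources: ZariskiSamuel1958 Ch. III §15; Matsumura1987 §5–§6; folklore.)
-/

noncomputable section

set_option linter.dupNamespace false

namespace Summit.ResolutionOfSingularities.ResolutionOfSingularities.Theorems.KStage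

open TensorProduct IsLocalRing
open Summit.ResolutionOfSingularities.ResolutionOfSingularities.Theorems.FrameStep

variable {k K L : Type} [Field k] [Field K] [Field L] [Algebra k K] [Algebra k L] [Algebra K L] [IsScalarTower k K L]

/-! ## §1 One stage -/

variable (K) in
/-- The multiplication map `μ_B : B ⊗_k K → L`, `b ⊗ c ↦ b·c`.  DEFINITION (support, data). -/
def mulMap (B : Subalgebra k L) : B ⊗[k] K →ₐ[k] L :=
  Algebra.TensorProduct.productMap B.val (IsScalarTower.toAlgHom k K L)

/-- `μ_B (b ⊗ c) = b·c`. -/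
theorem mulMap_tmul (B : Subalgebra k L) (b : B) (c : K) : mulMap K B (b ⊗ₜ[k] c) = (b : L) * algebraMap K L c := rfl

/-- `μ_{B'} ∘ (ι ⊗ id) = μ_B` for `B ≤ B'`. -/
theorem mulMap_comp_map {B B' : Subalgebra k L} (h : B ≤ B') :
    (mulMap K B').toRingHom.comp (Algebra.TensorProduct.map (Subalgebra.inclusion h) (AlgHom.id k K)).toRingHom =
      (mulMap K B).toRingHom := by
  have : (mulMap K B').comp (Algebra.TensorProduct.map (Subalgebra.inclusion h) (AlgHom.id k K)) = mulMap K B := by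
    refine Algebra.TensorProduct.ext' fun b c => ?_
    rw [AlgHom.comp_apply, Algebra.TensorProduct.map_tmul, mulMap_tmul, mulMap_tmul, AlgHom.id_apply,
      Subalgebra.coe_inclusion]
  exact congrArg AlgHom.toRingHom this

section One

variable (B : Subalgebra k L) (hμ : Function.Injective (mulMap K B).toRingHom) (W : Ideal (B ⊗[k] K)) [hW : W.IsPrime]

/-- `K ⊆ B̃`. -/
theorem algebraMap_mem_carrier (c : K) : algebraMap K L c ∈ KCarrier.carrier (mulMap K B).toRingHom hμ W := by
  have h := KCarrier.map_mem_carrier (mulMap K B).toRingHom hμ W ((1 : B) ⊗ₜ[k] c)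
  have he : (mulMap K B).toRingHom ((1 : B) ⊗ₜ[k] c) = algebraMap K L c := by
    change mulMap K B _ = _
    rw [mulMap_tmul, OneMemClass.coe_one, one_mul]
  rwa [he] at h

/-- `B ⊆ B̃`. -/
theorem coe_mem_carrier (b : B) : (b : L) ∈ KCarrier.carrier (mulMap K B).toRingHom hμ W := by
  have h := KCarrier.map_mem_carrier (mulMap K B).toRingHom hμ W (b ⊗ₜ[k] (1 : K))
  have he : (mulMap K B).toRingHom (b ⊗ₜ[k] (1 : K)) = (b : L) := by
    change mulMap K B _ = _
    rw [mulMap_tmul, map_one, mul_one]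
  rwa [he] at h

/-- `B ≤ B̃` as subrings of `L`. -/
theorem toSubring_le : B.toSubring ≤ KCarrier.carrier (mulMap K B).toRingHom hμ W :=
  fun _ hx => coe_mem_carrier B hμ W ⟨_, hx⟩

/-- Units of `B` are units of `B̃` (read in `L`). -/
theorem coe_mem_unitSet {b : B} (hb : IsUnit b) : (b : L) ∈ unitSet (KCarrier.carrier (mulMap K B).toRingHom hμ W) := by
  obtain ⟨u, rfl⟩ := hb
  have hu0 : ((u : B) : L) ≠ 0 := by
    intro h0
    have : (u : B) = 0 := Subtype.ext h0
    exact u.ne_zero this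
  refine mem_unitSet_iff.mpr ⟨coe_mem_carrier B hμ W _, ?_, hu0⟩
  have hinv : ((u : B) : L)⁻¹ = ((u⁻¹ : Bˣ) : B) := by
    refine inv_eq_of_mul_eq_one_right ?_
    exact_mod_cast u.mul_inv
  rw [hinv]
  exact coe_mem_carrier B hμ W _

/-- `μ(B ⊗ K)` lies in every subring containing `B` and `K`. -/
theorem range_le (R : Subring L) (hK : ∀ c : K, algebraMap K L c ∈ R) (hB : B.toSubring ≤ R) (x : B ⊗[k] K) :
    mulMap K B x ∈ R := by
  induction x using TensorProduct.induction_on with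
  | zero => rw [map_zero]; exact R.zero_mem
  | tmul b c => rw [mulMap_tmul]; exact R.mul_mem (hB b.2) (hK c)
  | add x y hx hy => rw [map_add]; exact R.add_mem hx hy

/-- **`hfrac`.**  `B̃` is a ring of fractions of `μ(B ⊗ K)` with denominators invertible in `B̃`. -/
theorem exists_frac (w : L) (hw : w ∈ KCarrier.carrier (mulMap K B).toRingHom hμ W) :
    ∃ y ∈ (mulMap K B).range.toSubring, ∃ z ∈ (mulMap K B).range.toSubring, z ≠ 0 ∧
      z⁻¹ ∈ KCarrier.carrier (mulMap K B).toRingHom hμ W ∧ w = y / z := by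
  obtain ⟨y, z, hz, rfl⟩ := hw
  exact ⟨mulMap K B y, ⟨y, rfl⟩, mulMap K B z, ⟨z, rfl⟩, KCarrier.map_ne_zero_of_not_mem (mulMap K B).toRingHom hμ W hz,
    KCarrier.inv_map_mem_carrier (mulMap K B).toRingHom hμ W hz, rfl⟩

/-- **`hrat`.**  If `𝔴` is maximal and `K`-rational then every element of `B̃` is a scalar modulo `𝔪_{B̃}`. -/
theorem exists_sub_mem_maxSet [W.IsMaximal] (hrat : ∀ y : (B ⊗[k] K) ⧸ W, ∃ a : K, Ideal.Quotient.mk W ((1 : B) ⊗ₜ[k] a) = y)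
    (w : L) (hw : w ∈ KCarrier.carrier (mulMap K B).toRingHom hμ W) :
    haveI := KCarrier.isLocalRing (mulMap K B).toRingHom hμ W;
    ∃ c : K, w - algebraMap K L c ∈ maxSet (KCarrier.carrier (mulMap K B).toRingHom hμ W) := by
  haveI := KCarrier.isLocalRing (mulMap K B).toRingHom hμ W
  obtain ⟨a, ha⟩ := KCarrier.exists_sub_mem_maxSet (mulMap K B).toRingHom hμ W
    (Algebra.TensorProduct.includeRight : K →ₐ[k] B ⊗[k] K).toRingHom (fun y => hrat y) w hw
  refine ⟨a, ?_⟩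
  have he : ((mulMap K B).toRingHom) ((Algebra.TensorProduct.includeRight : K →ₐ[k] B ⊗[k] K).toRingHom a) = algebraMap K L a := by
    change mulMap K B ((1 : B) ⊗ₜ[k] a) = _
    rw [mulMap_tmul, OneMemClass.coe_one, one_mul]
  rwa [he] at ha

/-- The structure map `B → B ⊗_k K → B̃` is the inclusion `B ≤ B̃`. -/
theorem inclusion_eq [IsLocalRing B] :
    letI := (KCarrier.toCarrier (mulMap K B).toRingHom hμ W).toAlgebra;
    (algebraMap (B ⊗[k] K) (KCarrier.carrier (mulMap K B).toRingHom hμ W)).comp (algebraMap B (B ⊗[k] K)) =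
      Subring.inclusion (toSubring_le B hμ W) := by
  refine RingHom.ext fun b => Subtype.ext ?_
  change mulMap K B (algebraMap B (B ⊗[k] K) b) = (b : L)
  rw [Algebra.TensorProduct.algebraMap_apply, Algebra.algebraMap_self, RingHom.id_apply, mulMap_tmul, map_one, mul_one]

/-- **`𝔪_B B̃ = 𝔪_{B̃}`** when `𝔴 ∩ B = 𝔪_B` (`KThread.map_comap_eq_maximalIdeal_of_isLocalization`, i.e. the geometric fibre of
`B → B ⊗_k K` over the closed point is a field for `K/k` separable algebraic [Theorems/KFibre]). -/
theorem map_maximalIdeal_eq [IsLocalRing B] [Algebra.IsSeparable k K]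
    (hWB : W.comap (algebraMap B (B ⊗[k] K)) = maximalIdeal B) :
    haveI := KCarrier.isLocalRing (mulMap K B).toRingHom hμ W;
    (maximalIdeal B).map (Subring.inclusion (toSubring_le B hμ W)) =
      maximalIdeal (KCarrier.carrier (mulMap K B).toRingHom hμ W) := by
  letI := (KCarrier.toCarrier (mulMap K B).toRingHom hμ W).toAlgebra
  haveI := KCarrier.isLocalization (mulMap K B).toRingHom hμ W
  haveI := KCarrier.isLocalRing (mulMap K B).toRingHom hμ W
  have h := KThread.map_comap_eq_maximalIdeal_of_isLocalization k K B W (KCarrier.carrier (mulMap K B).toRingHom hμ W)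
  rwa [hWB, inclusion_eq B hμ W] at h

/-- **`hM`.**  `x ∈ 𝔪_{B̃}` iff `x ∈ 𝔪_B B̃` (read in `L`). -/
theorem mem_maxSet_iff_mem_map [IsLocalRing B] [Algebra.IsSeparable k K]
    (hWB : W.comap (algebraMap B (B ⊗[k] K)) = maximalIdeal B) (x : L) :
    haveI := KCarrier.isLocalRing (mulMap K B).toRingHom hμ W;
    x ∈ maxSet (KCarrier.carrier (mulMap K B).toRingHom hμ W) ↔
      ∃ hx : x ∈ KCarrier.carrier (mulMap K B).toRingHom hμ W,
        (⟨x, hx⟩ : KCarrier.carrier (mulMap K B).toRingHom hμ W) ∈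
          (maximalIdeal B).map (Subring.inclusion (toSubring_le B hμ W)) := by
  haveI := KCarrier.isLocalRing (mulMap K B).toRingHom hμ W
  rw [map_maximalIdeal_eq B hμ W hWB]
  rfl

/-- `𝔪_B^n ⊆ 𝔪_{B̃}^n` (read in `L`). -/
theorem coe_mem_pow_maximalIdeal [IsLocalRing B] [Algebra.IsSeparable k K]
    (hWB : W.comap (algebraMap B (B ⊗[k] K)) = maximalIdeal B) (n : ℕ) {b : B} (hb : b ∈ maximalIdeal B ^ n) :
    haveI := KCarrier.isLocalRing (mulMap K B).toRingHom hμ W;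
    (⟨(b : L), coe_mem_carrier B hμ W b⟩ : KCarrier.carrier (mulMap K B).toRingHom hμ W) ∈
      maximalIdeal (KCarrier.carrier (mulMap K B).toRingHom hμ W) ^ n := by
  haveI := KCarrier.isLocalRing (mulMap K B).toRingHom hμ W
  have h : Subring.inclusion (toSubring_le B hμ W) b ∈
      ((maximalIdeal B).map (Subring.inclusion (toSubring_le B hμ W))) ^ n := by
    rw [← Ideal.map_pow]
    exact Ideal.mem_map_of_mem _ hb
  rw [map_maximalIdeal_eq B hμ W hWB] at h
  exact h

/-- `𝔪_B ⊆ 𝔪_{B̃}` (read in `L`). -/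
theorem coe_mem_maxSet [IsLocalRing B] [Algebra.IsSeparable k K]
    (hWB : W.comap (algebraMap B (B ⊗[k] K)) = maximalIdeal B) {b : B} (hb : b ∈ maximalIdeal B) :
    haveI := KCarrier.isLocalRing (mulMap K B).toRingHom hμ W;
    (b : L) ∈ maxSet (KCarrier.carrier (mulMap K B).toRingHom hμ W) := by
  haveI := KCarrier.isLocalRing (mulMap K B).toRingHom hμ W
  have h := coe_mem_pow_maximalIdeal B hμ W hWB 1 (b := b) (by rwa [pow_one])
  rw [pow_one] at h
  exact ⟨coe_mem_carrier B hμ W b, h⟩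

end One

/-! ## §2 Two stages -/

section Two

variable {B B' : Subalgebra k L} (h : B ≤ B') (hμ : Function.Injective (mulMap K B).toRingHom)
  (hμ' : Function.Injective (mulMap K B').toRingHom) (W : Ideal (B ⊗[k] K)) [hW : W.IsPrime]
  (W' : Ideal (B' ⊗[k] K)) [hW' : W'.IsPrime]
  (hWW : W'.comap (Algebra.TensorProduct.map (Subalgebra.inclusion h) (AlgHom.id k K)).toRingHom = W)

include hWW in
/-- `B̃ ⊆ B̃'`. -/
theorem carrier_le₂ : KCarrier.carrier (mulMap K B).toRingHom hμ W ≤ KCarrier.carrier (mulMap K B').toRingHom hμ' W' :=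
  KCarrier.carrier_le _ hμ W _ hμ' W' _ (mulMap_comp_map h) hWW

include hWW in
/-- `𝔪_{B̃} ⊆ 𝔪_{B̃'}`. -/
theorem maxSet_subset₂ :
    haveI := KCarrier.isLocalRing (mulMap K B).toRingHom hμ W; haveI := KCarrier.isLocalRing (mulMap K B').toRingHom hμ' W';
    maxSet (KCarrier.carrier (mulMap K B).toRingHom hμ W) ⊆ maxSet (KCarrier.carrier (mulMap K B').toRingHom hμ' W') :=
  KCarrier.maxSet_subset _ hμ W _ hμ' W' _ (mulMap_comp_map h) hWW

include hWW in
/-- Units of `B̃` are units of `B̃'`. -/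
theorem unitSet_subset₂ :
    unitSet (KCarrier.carrier (mulMap K B).toRingHom hμ W) ⊆ unitSet (KCarrier.carrier (mulMap K B').toRingHom hμ' W') :=
  KCarrier.unitSet_subset _ hμ W _ hμ' W' _ (mulMap_comp_map h) hWW

/-- **`hgen`.**  Every element of `B̃'` is `x / x'` with `x, x'` in the ring generated by `B̃ ∪ B'` and `x'` a unit of `B̃'`. -/
theorem exists_gen₂ (w : L) (hw : w ∈ KCarrier.carrier (mulMap K B').toRingHom hμ' W') :
    ∃ x ∈ Subring.closure ((KCarrier.carrier (mulMap K B).toRingHom hμ W : Set L) ∪ B'.toSubring),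
      ∃ x' ∈ Subring.closure ((KCarrier.carrier (mulMap K B).toRingHom hμ W : Set L) ∪ B'.toSubring),
        x' ∈ unitSet (KCarrier.carrier (mulMap K B').toRingHom hμ' W') ∧ w = x / x' := by
  have hcl : ∀ y : B' ⊗[k] K, mulMap K B' y ∈
      Subring.closure ((KCarrier.carrier (mulMap K B).toRingHom hμ W : Set L) ∪ B'.toSubring) := fun y =>
    range_le B' _ (fun c => Subring.subset_closure (Or.inl (algebraMap_mem_carrier B hμ W c)))
      (fun x hx => Subring.subset_closure (Or.inr hx)) y
  obtain ⟨y, z, hz, rfl⟩ := hw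
  exact ⟨_, hcl y, _, hcl z, KCarrier.map_mem_unitSet (mulMap K B').toRingHom hμ' W' hz, rfl⟩

end Two

/-! ## §3 The thread of `K`-rational points over a chain of local subalgebras -/

omit [Algebra K L] [IsScalarTower k K L] in
/-- **The thread of `K`-points** over a chain `B_0 ≤ B_1 ≤ ⋯` of local `k`-subalgebras of `L` with local inclusions and
residue fields algebraic over `k`, for `K ⊇ k` algebraically closed: maximal ideals `𝔴_i ⊆ B_i ⊗_k K` over the closed
points, `K`-rational, and compatible. (`KChain.exists_pointThread`.) -/
theorem exists_pointThread_subalgebra [IsAlgClosed K] (B : ℕ → Subalgebra k L) (hmono : ∀ i, B i ≤ B (i + 1))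
    [∀ i, IsLocalRing (B i)] (hloc : ∀ i, IsLocalHom (Subalgebra.inclusion (hmono i)).toRingHom)
    [∀ i, Algebra.IsAlgebraic k (ResidueField (B i))] :
    ∃ W : ∀ i, Ideal (B i ⊗[k] K),
      (∀ i, (W i).IsMaximal) ∧
      (∀ i, (W i).comap (algebraMap (B i) (B i ⊗[k] K)) = maximalIdeal (B i)) ∧
      (∀ i (y : (B i ⊗[k] K) ⧸ W i), ∃ a : K, Ideal.Quotient.mk (W i) ((1 : B i) ⊗ₜ[k] a) = y) ∧
      (∀ i, (W (i + 1)).comap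
        (Algebra.TensorProduct.map (Subalgebra.inclusion (hmono i)) (AlgHom.id k K)).toRingHom = W i) := by
  haveI := hloc
  exact KChain.exists_pointThread (fun i => B i) (fun i => Subalgebra.inclusion (hmono i)) K

end Summit.ResolutionOfSingularities.ResolutionOfSingularities.Theorems.KStage
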